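import Mathlib.Analysis.SpecialFunctions.Pow.Real
import Mathlib.Analysis.InnerProductSpace.PiL2
import Literature.Geometry.DiscreteGeometry.BondGraph
import Literature.MathematicalPhysics.StatisticalMechanics.LennardJonesClusters
import Literature.MathematicalPhysics.StatisticalMechanics.StablePotentialsProofs
import Summits.AtomisticToContinuum.Crystallization.Theorems.ThreeConeCertificateSlackRigidityThinning
import HarnessLib

/-!
# Line `barlow-relative-pricing` (crux `PricedLinkCensus.ChargedEnergyGap`, stmt-AtomisticToContinuum-14231): the regularisation step

Stub `stub_regularise` of the line skeleton: SEPARATION IS REMOVABLE in a priced charge gap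
relative to an ARBITRARY reference energy `e`.  Write `E(y) = ∑_{i<j} V_LJ(|yᵢ − yⱼ|)` and
`#ch(y)` for the number of CHARGED sites of `y : Fin N → ℝ³` (sites that are not charge-free at
tolerance `1/100`, `Literature.Geometry.DiscreteGeometry.IsChargeFree`).  GIVEN the recount bound
under deletion of one particle, `#ch(x) ≤ #ch(x ∘ i₀.succAbove) + F` (hypothesis; it is the
neighbouring stub of the line), and given `κ₁ > 0`, `C₁` with
`N·e + κ₁·#ch(y) − C₁·N^(2/3) ≤ E(y)` for all `1/3`-SEPARATED configurations `y`, there are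
`κ > 0` and `C` with `N·e + κ·#ch(y) − C·N^(2/3) ≤ E(y)` for ALL injective configurations `y`;
explicitly `κ = min κ₁ ((729·229/12)/(F+1))`, `C = max C₁ 0`.

Proof.  STEP A (`e ≤ 0`): test the separated hypothesis on `N = (m+1)³` collinear points at
spacing `2` (all mutual distances `≥ 2`, so `1/3`-separated and, by `lennardJones_nonpos`, of
energy `≤ 0`); dropping `κ₁·#ch ≥ 0` and using `((m+1)³)^(2/3) = (m+1)²` gives
`(m+1)³·e ≤ C₁·(m+1)²`, i.e. `(m+1)·e ≤ C₁` for every `m`, which is absurd for `e > 0`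
(Archimedes).  STEP B (induction on `N`, closest-pair deletion): a separated configuration is
covered by the hypothesis (`κ ≤ κ₁`, `#ch ≥ 0`, `C₁ ≤ C`, `N^(2/3) ≥ 0`).  Otherwise two points
are at distance `< 1/3`, and `exists_le_siteEnergy_of_dist_lt` (closest pair + shell sum) gives a
particle `i₀` of site energy `≥ 729·229/12`; by the removal identity
`interactionEnergy_eq_succAbove_add_siteEnergy`, `E(y) = E(y ∘ i₀.succAbove) + (≥ 729·229/12)`.
The induction hypothesis for the remaining `N − 1` points, the recount bound (the `+F` charged
sites cost `κ·F ≤ 729·229/12`), `e ≤ 0` (the extra `e` on the left) and `(N−1)^(2/3) ≤ N^(2/3)`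
close the step.  All `[folklore]`; the arithmetic is isolated in `sep_arith` / `step_arith`.
-/

noncomputable section

namespace Summit.AtomisticToContinuum.Crystallization.Theorems.BarlowRelativePricingRegularise

open scoped BigOperators Classical
open Literature.MathematicalPhysics.StatisticalMechanics Literature.Geometry.DiscreteGeometry
open Summit.AtomisticToContinuum.Crystallization.Theorems.CLayerWitnessThinning
  (exists_le_siteEnergy_of_dist_lt)

/-- Test configurations: for every `N` there is a `1/3`-separated configuration of `N` points in
`ℝ³` of non-positive Lennard-Jones energy — `N` collinear points at spacing `2` (all mutual
distances are `≥ 2 ≥ 1`, where `V_LJ ≤ 0`, `lennardJones_nonpos`). [folklore] -/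
theorem exists_separated_interactionEnergy_nonpos (N : ℕ) :
    ∃ y : Fin N → EuclideanSpace ℝ (Fin 3),
      (∀ i j : Fin N, i ≠ j → (1 / 3 : ℝ) ≤ dist (y i) (y j)) ∧
      interactionEnergy lennardJones y ≤ 0 := by
  have hd : ∀ i j : Fin N, i ≠ j → (2 : ℝ) ≤
      dist ((2 * ((i : ℕ) : ℝ)) • EuclideanSpace.single (0 : Fin 3) (1 : ℝ))
        ((2 * ((j : ℕ) : ℝ)) • EuclideanSpace.single (0 : Fin 3) (1 : ℝ)) := by
    intro i j hij
    have h1 : ‖EuclideanSpace.single (0 : Fin 3) (1 : ℝ)‖ = 1 := by simp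
    rw [dist_eq_norm, ← sub_smul, norm_smul, h1, mul_one, Real.norm_eq_abs]
    rcases lt_or_gt_of_ne (Fin.val_injective.ne hij) with h | h
    · have h' : ((i : ℕ) : ℝ) + 1 ≤ ((j : ℕ) : ℝ) := by exact_mod_cast h
      exact le_abs.2 (Or.inr (by linarith))
    · have h' : ((j : ℕ) : ℝ) + 1 ≤ ((i : ℕ) : ℝ) := by exact_mod_cast h
      exact le_abs.2 (Or.inl (by linarith))
  refine ⟨fun i => (2 * ((i : ℕ) : ℝ)) • EuclideanSpace.single (0 : Fin 3) (1 : ℝ),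
    fun i j hij => le_trans (by norm_num) (hd i j hij), ?_⟩
  unfold interactionEnergy
  refine Finset.sum_nonpos fun i _ => Finset.sum_nonpos fun j hj => ?_
  exact lennardJones_nonpos (le_trans (by norm_num) (hd i j (Finset.mem_Ioi.1 hj).ne))

/-- STEP A: a reference energy `e` admitting a separated priced charge gap is non-positive.
Testing the hypothesis on `(m+1)³` collinear points at spacing `2`
(`exists_separated_interactionEnergy_nonpos`) and dropping `κ₁·#ch ≥ 0` gives
`(m+1)³·e ≤ C₁·(m+1)²`, i.e. `(m+1)·e ≤ C₁` for every `m`; absurd for `e > 0`. [folklore] -/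
theorem nonpos_of_separated_gap {e κ₁ C₁ : ℝ} (hκ₁ : 0 < κ₁)
    (h : ∀ (N : ℕ) (y : Fin N → EuclideanSpace ℝ (Fin 3)),
      (∀ i j : Fin N, i ≠ j → (1 / 3 : ℝ) ≤ dist (y i) (y j)) →
        (N : ℝ) * e + κ₁ * (Nat.card {i : Fin N // ¬ IsChargeFree (1 / 100 : ℝ) y i} : ℝ)
          - C₁ * (N : ℝ) ^ (2 / 3 : ℝ) ≤ interactionEnergy lennardJones y) :
    e ≤ 0 := by
  by_contra he
  push Not at he
  obtain ⟨m, hm⟩ := exists_nat_ge (C₁ / e)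
  obtain ⟨y, hsep, hE⟩ := exists_separated_interactionEnergy_nonpos ((m + 1) ^ 3)
  have h1 := h ((m + 1) ^ 3) y hsep
  have hcard : (0 : ℝ) ≤
      κ₁ * (Nat.card {i : Fin ((m + 1) ^ 3) // ¬ IsChargeFree (1 / 100 : ℝ) y i} : ℝ) :=
    mul_nonneg hκ₁.le (Nat.cast_nonneg _)
  have hpow : ((((m + 1) ^ 3 : ℕ) : ℝ)) ^ (2 / 3 : ℝ) = ((m : ℝ) + 1) ^ 2 := by
    have h0 : (0 : ℝ) ≤ (m : ℝ) + 1 := by positivity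
    push_cast
    rw [← Real.rpow_natCast ((m : ℝ) + 1) 3, ← Real.rpow_mul h0]
    norm_num
  rw [hpow] at h1
  push_cast at h1
  have hme : C₁ < ((m : ℝ) + 1) * e := by
    have := (div_le_iff₀ he).1 hm
    linarith
  have hpos : (0 : ℝ) < (m : ℝ) + 1 := by positivity
  nlinarith [mul_pos (pow_pos hpos 2) (sub_pos.2 hme)]

/-- Arithmetic of the separated case: weakening the constants `κ₁ ↦ κ ≤ κ₁`, `C₁ ↦ max C₁ 0`
preserves the inequality since `D ≥ 0` and `r ≥ 0`. [folklore] -/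
theorem sep_arith {e κ κ₁ C₁ N D r Ex : ℝ} (hκ : κ ≤ κ₁) (hD : 0 ≤ D) (hr : 0 ≤ r)
    (h : N * e + κ₁ * D - C₁ * r ≤ Ex) : N * e + κ * D - max C₁ 0 * r ≤ Ex := by
  have h1 : κ * D ≤ κ₁ * D := mul_le_mul_of_nonneg_right hκ hD
  have h2 : C₁ * r ≤ max C₁ 0 * r := mul_le_mul_of_nonneg_right (le_max_left _ _) hr
  linarith

/-- Arithmetic of the deletion step: with `κ ≥ 0`, `κ·F ≤ 729·229/12`, `e ≤ 0`, from
`D ≤ D' + F`, `r' ≤ r`, `s ≥ 729·229/12`, `Ex = Ex' + s` and the induction hypothesis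
`n·e + κ·D' − max C₁ 0·r' ≤ Ex'` one gets `(n+1)·e + κ·D − max C₁ 0·r ≤ Ex`. [folklore] -/
theorem step_arith {e κ C₁ F n D D' r r' Ex Ex' s : ℝ} (hκ : 0 ≤ κ) (he : e ≤ 0)
    (hκF : κ * F ≤ 729 * 229 / 12) (hD : D ≤ D' + F) (hr : r' ≤ r) (hs : 729 * 229 / 12 ≤ s)
    (hE : Ex = Ex' + s) (ih : n * e + κ * D' - max C₁ 0 * r' ≤ Ex') :
    (n + 1) * e + κ * D - max C₁ 0 * r ≤ Ex := by
  have hC' : 0 ≤ max C₁ 0 := le_max_right _ _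
  have h1 : κ * D ≤ κ * (D' + F) := mul_le_mul_of_nonneg_left hD hκ
  have h2 : max C₁ 0 * r' ≤ max C₁ 0 * r := mul_le_mul_of_nonneg_left hr hC'
  linarith

/-- **Stub `stub_regularise` — separation is removable in a priced charge gap (closest-pair
deletion, explicit constants).**  Given the recount bound under deletion
`#ch(x) ≤ #ch(x ∘ i₀.succAbove) + F` (hypothesis) and, for a reference energy `e`, constants
`κ₁ > 0`, `C₁` with `N·e + κ₁·#ch(y) − C₁·N^(2/3) ≤ E_LJ(y)` for all `1/3`-separated
`y : Fin N → ℝ³`, the constants `κ = min κ₁ ((729·229/12)/(F+1)) > 0`, `C = max C₁ 0` satisfy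
`N·e + κ·#ch(y) − C·N^(2/3) ≤ E_LJ(y)` for all injective `y`.  First `e ≤ 0`
(`nonpos_of_separated_gap`, collinear test configurations); then induction on `N`, deleting a
particle of site energy `≥ 729·229/12` (`exists_le_siteEnergy_of_dist_lt`,
`interactionEnergy_eq_succAbove_add_siteEnergy`), the `+F` recounted charges costing
`κ·F ≤ 729·229/12`. [folklore] -/
theorem stub_regularise : (∃ F : ℕ, ∀ (N : ℕ) (x : Fin (N + 1) → EuclideanSpace ℝ (Fin 3)) (i₀ : Fin (N + 1)), Function.Injective x → Nat.card {i : Fin (N + 1) // ¬ Literature.Geometry.DiscreteGeometry.IsChargeFree (1 / 100 : ℝ) x i} ≤ Nat.card {i : Fin N // ¬ Literature.Geometry.DiscreteGeometry.IsChargeFree (1 / 100 : ℝ) (x ∘ Fin.succAbove i₀) i} + F) → ∀ e : ℝ, (∃ κ : ℝ, 0 < κ ∧ ∃ C : ℝ, ∀ (N : ℕ) (y : Fin N → EuclideanSpace ℝ (Fin 3)), (∀ i j : Fin N, i ≠ j → (1 / 3 : ℝ) ≤ dist (y i) (y j)) → (N : ℝ) * e + κ * (Nat.card {i : Fin N // ¬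 Literature.Geometry.DiscreteGeometry.IsChargeFree (1 / 100 : ℝ) y i} : ℝ) - C * (N : ℝ) ^ (2 / 3 : ℝ) ≤ Literature.MathematicalPhysics.StatisticalMechanics.interactionEnergy Literature.MathematicalPhysics.StatisticalMechanics.lennardJones y) → ∃ κ : ℝ, 0 < κ ∧ ∃ C : ℝ, ∀ (N : ℕ) (y : Fin N → EuclideanSpace ℝ (Fin 3)), Function.Injective y → (N : ℝ) * e + κ * (Nat.card {i : Fin N // ¬ Literature.Geometry.DiscreteGeometry.IsChargeFree (1 / 100 : ℝ) y i} : ℝ) - C * (N : ℝ) ^ (2 / 3 : ℝ) ≤ Literature.MathematicalPhysics.StatisticalMechanics.interactionEnergy Literature.MathematicalPhysics.StatisticalMechanics.lennardJones y := by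
  rintro ⟨F, hF⟩ e ⟨κ₁, hκ₁, C₁, hsep⟩
  have he : e ≤ 0 := nonpos_of_separated_gap hκ₁ hsep
  have hκpos : 0 < min κ₁ (729 * 229 / 12 / ((F : ℝ) + 1)) := lt_min hκ₁ (by positivity)
  refine ⟨min κ₁ (729 * 229 / 12 / ((F : ℝ) + 1)), hκpos, max C₁ 0, ?_⟩
  have hκF : min κ₁ (729 * 229 / 12 / ((F : ℝ) + 1)) * F ≤ 729 * 229 / 12 := by
    calc min κ₁ (729 * 229 / 12 / ((F : ℝ) + 1)) * F
        ≤ 729 * 229 / 12 / ((F : ℝ) + 1) * ((F : ℝ) + 1) :=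
          mul_le_mul (min_le_right _ _) (by linarith) (Nat.cast_nonneg _) (by positivity)
      _ = 729 * 229 / 12 := div_mul_cancel₀ _ (by positivity)
  intro N
  induction N with
  | zero =>
    intro y hy
    exact sep_arith (min_le_left _ _) (Nat.cast_nonneg _) (Real.rpow_nonneg (Nat.cast_nonneg _) _)
      (hsep 0 y fun i => i.elim0)
  | succ n ih =>
    intro y hy
    by_cases hs : ∀ i j : Fin (n + 1), i ≠ j → (1 / 3 : ℝ) ≤ dist (y i) (y j)
    · exact sep_arith (min_le_left _ _) (Nat.cast_nonneg _)
        (Real.rpow_nonneg (Nat.cast_nonneg _) _) (hsep (n + 1) y hs)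
    push Not at hs
    obtain ⟨i, j, hij, hlt⟩ := hs
    -- delete a particle `i₀` of a closest pair: its site energy is `≥ 729·229/12`
    obtain ⟨i₀, hi₀⟩ := exists_le_siteEnergy_of_dist_lt hy hij hlt
    have hy' : Function.Injective (y ∘ i₀.succAbove) := hy.comp Fin.succAbove_right_injective
    have hE : interactionEnergy lennardJones y =
        interactionEnergy lennardJones (y ∘ i₀.succAbove) + siteEnergy lennardJones y i₀ :=
      interactionEnergy_eq_succAbove_add_siteEnergy lennardJones lennardJones_zero y i₀
    -- the induction hypothesis for the remaining `n` points and the recount bound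
    have hih := ih (y ∘ i₀.succAbove) hy'
    have hDR := (Nat.cast_le (α := ℝ)).2 (hF n y i₀ hy)
    push_cast at hDR
    have hrpow : (n : ℝ) ^ (2 / 3 : ℝ) ≤ ((n : ℝ) + 1) ^ (2 / 3 : ℝ) :=
      Real.rpow_le_rpow (Nat.cast_nonneg _) (by linarith) (by norm_num)
    rw [Nat.cast_succ]
    exact step_arith hκpos.le he hκF hDR hrpow hi₀ hE hih

end Summit.AtomisticToContinuum.Crystallization.Theorems.BarlowRelativePricingRegularise

end
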